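import Summits.Ventures.CertifiedArithmetic.LowPrec.DoubleRoundingSqrtThreshold
import Summits.Ventures.CertifiedArithmetic.LowPrec.DoubleRoundingSqrtUnderflowTable

/-!
# Below the underflow clause of the square root, VI: the capture table in the kernel, readings

HONEST FRAMING: certified error envelopes and provably optimal rounding/accumulation schemes for
low-precision formats under stated cost models; every table by two implementations; no hardware or
vendor claims.

Implementation B of THEOREM D-sqrt-T (`DoubleRoundingSqrtThreshold.lean`; implementation A
`code/enum/sqrt_threshold_law.py`, certificate `certs/enum/DOUBLE-ROUNDING-SQRT-THRESHOLD.json`).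
§4: the capture table `sqrtCapFree m` for `m = 1 … 5` by `decide +kernel` (`48 384` captures
tested at `m = 5`; `m = 6, 7, 8` — `260 096`, `1 305 600`, `6 540 800` captures — by
implementation A only: one kernel evaluation of `m = 6` does not fit a declaration's budget
reliably), its tight cases `κ = 3m + 7` (the failure family, and at `m = 6` the Ramanujan–Nagell
coincidence `181² + 7 = 2^15`), and THEOREM D-sqrt-T for every source with `m ≤ 5`. §5: readings
— e3m2 through `⟨7,b,14,127⟩` is innocuous iff `b ≥ 2` (`d ≥ 4`; the bias-3 cell of
DOUBLE-ROUNDING-SQRT.md §5 decided before by exhaustion only), e4m3 through ANY register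
`ψ ⊇ e4m3` with `P_ψ ≥ 10` iff `d ≥ 3`, e5m2 through any register with `P_ψ ≥ 8` and `d ≥ 1`; and
the toy cross-table threshold test ⟷ exhaustion. [this packet]
-/

namespace Summit.Ventures.CertifiedArithmetic

open Literature.ComputerArithmetic.FloatingPoint
open Literature.ComputerArithmetic.FloatingPoint.Format
open Literature.ComputerArithmetic.FloatingPoint.MiniFloat

/-! ## §4 The capture table for `m ≤ 5` and THEOREM D-sqrt-T for such sources -/

/-- THE CAPTURE TABLE IN THE KERNEL: `sqrtCapFree m` for `m = 1, …, 5` — no midpoint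
`(2V+1) 2^G`, `G ≤ m + 2`, captures the root of an operand `A 2^κ` with `κ ≥ 3m + 8` (one kernel
evaluation per conjunct; implementation A: `code/enum/sqrt_threshold_law.py`, also `m = 6, 7, 8`).
[this packet] -/
theorem sqrtCapFree_table : sqrtCapFree 1 = true ∧ sqrtCapFree 2 = true ∧ sqrtCapFree 3 = true ∧
    sqrtCapFree 4 = true ∧ sqrtCapFree 5 = true := by
  refine ⟨?_, ?_, ?_, ?_, ?_⟩ <;> decide +kernel

/-- Hence the table hypothesis of THEOREM D-sqrt-T for every `1 ≤ m ≤ 5`. [this packet] -/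
theorem sqrtCapFree_of_le_five {m : ℕ} (h1 : 1 ≤ m) (h5 : m ≤ 5) : sqrtCapFree m = true := by
  obtain ⟨t1, t2, t3, t4, t5⟩ := sqrtCapFree_table
  interval_cases m
  exacts [t1, t2, t3, t4, t5]

/-- THE BOUND `κ ≤ 3m + 7` IS ATTAINED: by the failure family (`V = A = 2^(m+1) - 1`,
`G = m + 2`) for each `m ≤ 6`, and at `m = 6` also by `181² + 7 = 2^15` (`V = 90`, `A = 1`,
`G = 5`: `Z - M² = 4^5 · 7 ≤ 2M + 1`). [this packet] -/
theorem sqrtCapAt_tight :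
    ((List.range 6).all fun i =>
      sqrtCapAt (i + 3) (2 ^ (i + 2) - 1) (2 ^ (i + 2) - 1) (3 * (i + 1) + 7)) = true ∧
    sqrtCapAt 5 90 1 25 = true ∧ (181 : ℕ) ^ 2 + 7 = 2 ^ 15 := by
  refine ⟨?_, ?_, ?_⟩ <;> decide +kernel

/-- THEOREM D-sqrt-T FOR SOURCES WITH `m ≤ 5` (every FP4/FP6/FP8 record of the cell and all toy
sources): `F_φ ⊆ F_ψ`, `P_ψ ≥ 2P_φ + 2`, `1 ≤ m_φ ≤ 5`, `quantum_φ = 2^d quantum_ψ`, `d ≥ 1`, the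
family at binade `g₀ = (bias_φ - 1)/2` in range: `DRSqrt φ ψ ↔ d + g₀ ≥ m_φ + 3`. [this packet] -/
theorem drSqrt_iff_threshold_of_le_five {φ ψ : Format} (h5 : φ.manBits ≤ 5)
    (hE : embedsTest φ ψ = true) (hm : 2 * φ.manBits + 3 ≤ ψ.manBits) (h1 : 1 ≤ φ.manBits)
    (hq1 : ψ.qexp + 1 ≤ φ.qexp)
    (hR : (2 ^ (φ.manBits + 1) - 1) * 2 ^ (2 * ((φ.bias - 1) / 2) + 2 - φ.bias) ≤ φ.maxScaled)
    (hu : 2 ^ (φ.manBits + 1) * 2 ^ ((φ.bias - 1) / 2) ≤ φ.maxScaled) :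
    DRSqrt φ ψ ↔ φ.manBits + 3 ≤ (φ.qexp - ψ.qexp).toNat + (φ.bias - 1) / 2 :=
  drSqrt_iff_threshold (sqrtCapFree_of_le_five h1 h5) hE hm h1 hq1 hR hu

/-- … and its sufficiency half without range hypotheses. [this packet] -/
theorem drSqrt_of_threshold_of_le_five {φ ψ : Format} (h5 : φ.manBits ≤ 5)
    (hE : embedsTest φ ψ = true) (hm : 2 * φ.manBits + 3 ≤ ψ.manBits) (h1 : 1 ≤ φ.manBits)
    (hq1 : ψ.qexp + 1 ≤ φ.qexp)
    (hd : φ.manBits + 3 ≤ (φ.qexp - ψ.qexp).toNat + (φ.bias - 1) / 2) : DRSqrt φ ψ :=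
  drSqrt_of_capFree (sqrtCapFree_of_le_five h1 h5) hE hm h1 hq1 hd

/-! ## §5 Readings -/

/-- e4m3 (`m = 3`, bias `7`, `g₀ = 3`) THROUGH ANY REGISTER: for every record `ψ ⊇ e4m3` with
`P_ψ ≥ 10` and `quantum_ψ ∣ quantum_e4m3 / 2`, the square root is innocuous iff
`quantum_e4m3 / quantum_ψ ≥ 2^3` (`d ≥ 3 = m + 3 - g₀`; depths `1, 2` fail at the operand
`15 · 2^-8`-type family of binade `3`). [this packet] -/
theorem drSqrt_E4M3_iff {ψ : Format} (hE : embedsTest E4M3 ψ = true) (hm : 9 ≤ ψ.manBits)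
    (hq1 : ψ.qexp + 1 ≤ E4M3.qexp) : DRSqrt E4M3 ψ ↔ ψ.qexp + 3 ≤ E4M3.qexp := by
  have h := drSqrt_iff_threshold_of_le_five (φ := E4M3) (by decide) hE (by simpa [E4M3] using hm)
    (by decide) hq1 (by decide) (by decide)
  rw [h]
  have hD : (((E4M3.qexp - ψ.qexp).toNat : ℕ) : ℤ) = E4M3.qexp - ψ.qexp :=
    Int.toNat_of_nonneg (by omega)
  simp only [E4M3] at hD ⊢
  omega

/-- e5m2 (`m = 2`, bias `15`, `g₀ = 7 ≥ m + 2`) THROUGH ANY REGISTER: every record `ψ ⊇ e5m2`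
with `P_ψ ≥ 8` and a strictly finer quantum is innocuous for the square root — no underflow or
depth clause needed. [this packet] -/
theorem drSqrt_E5M2_of_embeds {ψ : Format} (hE : embedsTest E5M2 ψ = true) (hm : 7 ≤ ψ.manBits)
    (hq1 : ψ.qexp + 1 ≤ E5M2.qexp) : DRSqrt E5M2 ψ := by
  refine drSqrt_of_threshold_of_le_five (φ := E5M2) (by decide) hE (by simpa [E5M2] using hm)
    (by decide) hq1 ?_
  have hD : (((E5M2.qexp - ψ.qexp).toNat : ℕ) : ℤ) = E5M2.qexp - ψ.qexp :=
    Int.toNat_of_nonneg (by omega)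
  simp only [E5M2] at hD ⊢
  omega

/-- e3m2 (`m = 2`, bias `3`, `g₀ = 1`) through the toy records `⟨7, b, 14, 127⟩` of
DOUBLE-ROUNDING-SQRT.md §5 (`P = 8 = 2·3 + 2`; embedded iff `b ≤ 10`; `d = b + 2`): innocuous
iff `b ≥ 2`, i.e. iff `d ≥ 4 = m + 3 - g₀` — the bias-3 column of §5 is now a theorem, including
its cell `b = 2` (`d = 4 = m + 2`) that neither THEOREM D-sqrt-U′ nor LAW N-sqrt-U′ reached.
[this packet] -/
theorem drSqrt_E3M2_toy7_iff {b : ℕ} (hb : b ≤ 10) : DRSqrt E3M2 (sqrtToy7 b) ↔ 2 ≤ b := by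
  have hE : embedsTest E3M2 (sqrtToy7 b) = true := by
    interval_cases b <;> decide +kernel
  have h := drSqrt_iff_threshold_of_le_five (φ := E3M2) (by decide) hE (by simp [sqrtToy7, E3M2])
    (by decide) (by simp [Format.qexp, sqrtToy7, E3M2]; omega) (by decide) (by decide)
  rw [h]; simp [Format.qexp, sqrtToy7, E3M2]; omega

/-- e4m3 through the toy records `⟨9, b, 14, 511⟩` (`P = 10`; embedded iff `b ≤ 6`; `d = b - 1`,
`d ≥ 1` iff `b ≥ 2`): innocuous iff `b ≥ 4` (`d ≥ 3`). [this packet] -/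
theorem drSqrt_E4M3_toy9_iff {b : ℕ} (hb2 : 2 ≤ b) (hb : b ≤ 6) :
    DRSqrt E4M3 (sqrtToy9 b) ↔ 4 ≤ b := by
  have hE : embedsTest E4M3 (sqrtToy9 b) = true := by
    interval_cases b <;> decide +kernel
  rw [drSqrt_E4M3_iff hE (by simp [sqrtToy9]) (by simp [Format.qexp, sqrtToy9, E4M3]; omega)]
  simp [Format.qexp, sqrtToy9, E4M3]; omega

/-- The toy pairs of this file's cross-table: e3m2 → `⟨7,b,14,127⟩` (`b < 12`) and e4m3 →
`⟨9,b,14,511⟩` (`b < 8`). -/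
def sqrtThreshPairs : List (Format × Format) :=
  (List.range 12).map (fun b => (E3M2, sqrtToy7 b)) ++
    (List.range 8).map (fun b => (E4M3, sqrtToy9 b))

/-- THE TOY CROSS-TABLE IN THE KERNEL (implementation B; implementation A:
`code/enum/sqrt_threshold_law.py`): per pair `(d, F_X ⊆ F_Y, threshold test, shallow test at
g₀, DRSqrt by exhaustion)`. On every embedded row with `d ≥ 1` the threshold test and exhaustion
AGREE and the shallow test is their negation: e3m2 rows `b = 0, 1` fail (`d = 2, 3`), `b = 2 … 10`
hold, `b = 11` is not embedded; e4m3 rows `b = 2, 3` fail (`d = 1, 2`), `b = 4, 5, 6` hold; `b = 0,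
1` (`d ≤ 0`: outside the theorem) fail and `b = 7` is not embedded (exhaustion still reports on
them). [this packet] -/
theorem sqrtThreshPairs_table :
    sqrtThreshPairs.map (fun p => ((p.1.qexp - p.2.qexp).toNat, embedsTest p.1 p.2,
      drSqrtThreshTest p.1 p.2, drSqrtShallowTest p.1 p.2 ((p.1.bias - 1) / 2),
      drSqrtExh p.1 p.2)) =
    [(2, true, false, true, false), (3, true, false, true, false),
    (4, true, true, false, true), (5, true, true, false, true), (6, true, true, false, true),
    (7, true, true, false, true), (8, true, true, false, true), (9, true, true, false, true),
    (10, true, true, false, true), (11, true, true, false, true), (12, true, true, false, true),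
    (13, false, false, false, true),
    (0, false, false, false, false), (0, true, false, false, false),
    (1, true, false, true, false), (2, true, false, true, false),
    (3, true, true, false, true), (4, true, true, false, true), (5, true, true, false, true),
    (6, false, false, false, true)] := by
  decide +kernel

end Summit.Ventures.CertifiedArithmetic
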